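import Literature.NumberTheory.EllipticCurves.KummerImageIsotropy
import Literature.NumberTheory.EllipticCurves.WeilPairingProofs
import Literature.NumberTheory.EllipticCurves.PeriodIndexObstructionLocal
import Literature.NumberTheory.GaloisRepresentations.ContinuousH2
import Literature.NumberTheory.GaloisRepresentations.GaloisCohomologyProofs
import HarnessLib

/-!
# The Kummer image is isotropic: proof of `kummerClass_cupProduct_kummerClass_eq_zero`

`Proofs`-style sibling (D-0014 append protocol; no named fact, no instance) of
`Literature/NumberTheory/EllipticCurves/KummerImageIsotropy.lean`, discharging its named fact
`Literature.NumberTheory.EllipticCurves.kummerClass_cupProduct_kummerClass_eq_zero F`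
(Poonen–Rains 2012, Prop. 4.8 with Cor. 4.6: the image of the Kummer map
`E(F)/n → H¹(F, E[n])` is isotropic for the cup product `∪ₑ : H¹ × H¹ → H²(F, μₙ)` of the Weil
pairing) for every field `F`: `kummerClass_cupProduct_kummerClass_eq_zero_holds`.

## The argument

Poonen–Rains prove (Prop. 4.8) that the Kummer classes lift to `H¹` of Mumford's Heisenberg
(theta) group `1 → 𝔾_m → ℋ → E[n] → 0`, so that the connecting quadratic map `q` vanishes on
them, and (Cor. 4.6, after Zarhin) that the bilinear form attached to `q` is the cup product of
the Weil pairing; isotropy follows.  Here the same cocycle computation is carried out directly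
with the tree's Weil functions (Silverman, *AEC*, III.§8: `e_n(S, T) = τ_S^* g_T / g_T` for `g_T`
with `div g_T = Σ_{R ∈ E[n]} (T' + R) - (R)`, `nT' = T`; `WeierstrassCurve.weilPairingFun`,
`WeierstrassCurve.IsWeilFunction` of `WeilPairingProofs`), so that no group object is needed:

1. (`exists_thetaFn`, `weilCob`, `isWeilFunction_weilCob`, `weilCob_mul`.)  For `A ∈ E(F̄)` let
   `Ψ_A` have divisor `Σ_{R ∈ E[n]} [(A + R) - (R)] + (O) - (n²A)` (Silverman Cor. III.3.5).  For
   `σ ∈ Γ_F` fixing `n²A`, `g_σ = τ_A^*(σ̃Ψ_A/Ψ_A)` is a Weil function for `n(σA - A)` with root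
   `σA - A`, and **exactly** `g_{στ} = g_σ · τ_{-(σA-A)}^*(σ̃ g_τ)` — the cocycle identity of a
   lift to the theta group of `[n]^*(O)`.
2. (`weilPairingFun_mul_cobConst`.)  Let `nP₁ = P`, `n Q₂ = Q₁`, `nQ₁ = Q` with `P, Q ∈ E(F)`,
   `s_σ = σP₁ - P₁`, `t_σ = σQ₁ - Q₁` (the Kummer cocycles).  Both `g_σ` (for `A = Q₂`) and
   `h_σ` (for `A = P₁ + Q₂`) are Weil functions for `t_σ` (with roots `σQ₂ - Q₂` and
   `s_σ + σQ₂ - Q₂`), hence `h_σ = u_σ g_σ` with `u_σ ∈ F̄^×`; substituting into the two cocycle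
   identities and using `τ_S^* g = e_n(S, t) g` (`IsWeilFunction.transAlgHom_eq`) gives
   **`e_n(s_σ, σ t_τ) · u_{στ} = u_σ · σ(u_τ)`**: the cup-product cocycle
   `(σ, τ) ↦ e_n(s_σ, σ t_τ)` (`ContPairing.cupCocycle_apply_eq_smul`) is `∂u`.
3. (`isLocallyConstant_cobConst`, `exists_mu_coboundary`.)  `σ ↦ σ̃z` is locally constant
   (the tree's `isLocallyConstant_galFunctionField` of `PeriodIndexObstructionLocal`), hence so
   is `u`; `(∂u)^n = 1`, so `u^n` is a locally constant `F̄^×`-valued `1`-cocycle, `= σλ/λ` by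
   Hilbert 90 (`AlgEquiv.exists_smul_div_eq_of_isOpen` of `GaloisCohomologyProofs`), and
   `b = u λ₁/σλ₁` (`λ₁^n = λ`) is `μₙ`-valued with `∂b = ∂u`.
4. (`exists_addOrderOf_eq`, `exists_isPrimitiveRoot_weilPairingFun`, `exists_eq_nsmul_add_nsmul`,
   `exists_pairing_eq_weilPairingFun_pow`.)  The fact quantifies over every alternating biadditive
   equivariant `μₙ`-valued `e` on `E[n]`; each is `e_n^c`: `E[n]` has a point `P₀` of order `n`
   (exponent against `#E[k] = k²`, Silverman Cor. III.6.4(b)), the values `e_n(P₀, ·)` form a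
   cyclic subgroup of `F̄^×` whose order `d` kills `P₀` by non-degeneracy, so some `e_n(P₀, Q₀)`
   is a primitive `n`-th root of unity (Cor. III.8.1.1), `E[n] = ⟨P₀, Q₀⟩`, and an alternating
   biadditive pairing is determined by its value at `(P₀, Q₀)`.
5. (`kummerClass_cupProduct_kummerClass_eq_zero_holds`.)  The cocycle of `e = e_n^c` is `∂(b^c)`,
   a continuous coboundary, so its class is `0` (`twoCocycleClass_eq_zero_iff`).

## References

* [PoonenRains2012] B. Poonen, E. Rains, *Random maximal isotropic subspaces and Selmer groups*,
  J. Amer. Math. Soc. 25 (2012), 245–269, §4.1: Prop. 4.5, Cor. 4.6, Prop. 4.8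
  (arXiv:1009.0287) — the statement and the theta-group argument reproduced here.
* [SilvermanAEC2009] J. H. Silverman, *The Arithmetic of Elliptic Curves*, 2nd ed., GTM 106
  (2009): III.§8 (Weil pairing via `g_T`), Prop. III.8.1, Cor. III.8.1.1, Cor. III.3.5,
  Cor. III.6.4(b); X.§2–3 (Galois action on `K̄(E)`).
* Yu. G. Zarhin, *Noncommutative cohomology and Mumford groups*, Mat. Zametki 15 (1974) 415–419
  (the quadratic identity behind Cor. 4.6; cited through Poonen–Rains).
* J.-P. Serre, *Local Fields*, X.§1 Prop. 2 (Hilbert 90); *Galois Cohomology*, I.§2.2–2.3.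

## Design

`noncomputable section`, `open scoped Classical`, one universe `u`.  Sections 1–4 are
dot-notation extensions in `namespace WeierstrassCurve` next to `WeilPairingProofs` (the level
`m : ℕ` and `hm : (m : F) ≠ 0` threaded as there, `include hm`); the discharge lives in
`Literature.NumberTheory.EllipticCurves` with the fact.  New definitions are auxiliary and real
(`thetaFn`, `weilCob`, `cobConst`: chosen functions/constants with their defining properties
proved; `muFieldVal`, `muOfFieldVal`: the underlying-value interface of `MuCarrier`); no `Prop`-valued
definition is introduced.
-/

noncomputable section

open scoped Classical

universe u

namespace WeierstrassCurve

open geomPoints Literature.NumberTheory.EllipticCurves.WeierstrassFunctionField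
open Literature.NumberTheory.EllipticCurves

variable {F : Type u} [Field F] (W : WeierstrassCurve F)

/-! ### The auxiliary functions `Ψ_A` -/

section Theta

variable {W} {m : ℕ} [W.IsElliptic] (hm : (m : F) ≠ 0)
include hm

omit [W.IsElliptic] in
/-- `m ≠ 0` in `ℤ` (the statement of the tree's lemma of the same content in
`WeilPairingAdjointProofs`, restated to keep the imports of this file small). [folklore] -/
theorem intCast_ne_zero_of_natCast_ne_zero : (m : ℤ) ≠ 0 := by
  rintro h
  exact hm (by rw [Int.natCast_eq_zero.mp h, Nat.cast_zero])

/-- **The auxiliary function `Ψ_A`**: for every `A ∈ E(F̄)` there is `Ψ ∈ F̄(E)^×` with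
`div Ψ = Σ_{R ∈ E[m]} [(A + R) - (R)] + (O) - (m²A)` (degree `0`, sum `m² A - m² A = O`;
Silverman, *AEC*, Cor. III.3.5). [cite: SilvermanAEC2009, Cor. III.3.5] -/
theorem exists_thetaFn (A : W.geomPoints) :
    ∃ Ψ : W.geomFunctionField, Ψ ≠ 0 ∧ ∀ P : W.geomPoints,
      ord (W.baseChange (AlgebraicClosure F)).toAffine P Ψ =
        torsionInd W m (P - A) - torsionInd W m P +
          ((if P = 0 then (1 : ℤ) else 0) - (if P = (m : ℤ) • ((m : ℤ) • A) then (1 : ℤ) else 0)) := by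
  have hsum : ∑ i ∈ Finset.insertNone (torsionFinset (W := W) hm),
      (Option.elim i (0 : W.geomPoints) (fun R ↦ A + R) -
        Option.elim i ((m : ℤ) • ((m : ℤ) • A)) (fun R ↦ R)) = 0 := by
    rw [Finset.sum_insertNone]
    simp only [Option.elim_none, Option.elim_some, add_sub_cancel_right, Finset.sum_const,
      card_torsionFinset hm, zero_sub]
    rw [pow_two, mul_nsmul, ← natCast_zsmul, ← natCast_zsmul, neg_add_cancel]
  obtain ⟨Ψ, hΨ0, hΨ⟩ := exists_ord_eq_of_pairs (W := W) (Finset.insertNone (torsionFinset (W := W) hm))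
    (fun i ↦ Option.elim i (0 : W.geomPoints) (fun R ↦ A + R))
    (fun i ↦ Option.elim i ((m : ℤ) • ((m : ℤ) • A)) (fun R ↦ R)) hsum
  refine ⟨Ψ, hΨ0, fun P ↦ ?_⟩
  rw [hΨ P, Finset.sum_insertNone, Finset.sum_sub_distrib]
  have e1 : (∑ x ∈ torsionFinset (W := W) hm,
      if P = Option.elim (some x) (0 : W.geomPoints) (fun R ↦ A + R) then (1 : ℤ) else 0) =
      torsionInd W m (P - A) := sum_ite_eq_add hm P A
  have e2 : (∑ x ∈ torsionFinset (W := W) hm,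
      if P = Option.elim (some x) ((m : ℤ) • ((m : ℤ) • A)) (fun R ↦ R) then (1 : ℤ) else 0) =
      torsionInd W m P := sum_ite_eq_self hm P
  have e3 : (if P = Option.elim none (0 : W.geomPoints) (fun R ↦ A + R) then (1 : ℤ) else 0) =
      if P = 0 then (1 : ℤ) else 0 := rfl
  have e4 : (if P = Option.elim none ((m : ℤ) • ((m : ℤ) • A)) (fun R ↦ R) then (1 : ℤ) else 0) =
      if P = (m : ℤ) • ((m : ℤ) • A) then (1 : ℤ) else 0 := rfl
  rw [e1, e2, e3, e4]
  abel

/-- A chosen auxiliary function `Ψ_A` (`exists_thetaFn`). [folklore] -/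
def thetaFn (A : W.geomPoints) : W.geomFunctionField := (exists_thetaFn hm A).choose

/-- `Ψ_A ≠ 0`. [folklore] -/
theorem thetaFn_ne_zero (A : W.geomPoints) : thetaFn hm A ≠ 0 := (exists_thetaFn hm A).choose_spec.1

/-- The divisor of `Ψ_A`. [folklore] -/
theorem ord_thetaFn (A P : W.geomPoints) :
    ord (W.baseChange (AlgebraicClosure F)).toAffine P (thetaFn hm A) =
      torsionInd W m (P - A) - torsionInd W m P +
        ((if P = 0 then (1 : ℤ) else 0) - (if P = (m : ℤ) • ((m : ℤ) • A) then (1 : ℤ) else 0)) :=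
  (exists_thetaFn hm A).choose_spec.2 P

/-- **The Weil-function cocycle** `g_σ = τ_A^* (σ̃ Ψ_A / Ψ_A)` attached to `A ∈ E(F̄)` and
`σ ∈ Γ_F`. [folklore] -/
def weilCob (A : W.geomPoints) (σ : Field.absoluteGaloisGroup F) : W.geomFunctionField :=
  W.transAlgHom A (W.galFunctionField σ (thetaFn hm A) / thetaFn hm A)

/-- `σ̃ Ψ_A ≠ 0`. [folklore] -/
theorem galFunctionField_thetaFn_ne_zero (A : W.geomPoints) (σ : Field.absoluteGaloisGroup F) :
    W.galFunctionField σ (thetaFn hm A) ≠ 0 :=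
  (map_ne_zero_iff _ (W.galFunctionField σ).injective).mpr (thetaFn_ne_zero hm A)

/-- `g_σ ≠ 0`. [folklore] -/
theorem weilCob_ne_zero (A : W.geomPoints) (σ : Field.absoluteGaloisGroup F) :
    weilCob hm A σ ≠ 0 :=
  (map_ne_zero_iff _ (W.transAlgHom A).injective).mpr
    (div_ne_zero (galFunctionField_thetaFn_ne_zero hm A σ) (thetaFn_ne_zero hm A))

/-- **`g_σ` is a Weil function** for `m(σA - A)` with root `σA - A`, as soon as `σ` fixes
`m²A`: `div g_σ = Σ_{R ∈ E[m]} [(σA - A + R) - (R)]`. [folklore] -/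
theorem isWeilFunction_weilCob (A : W.geomPoints) (σ : Field.absoluteGaloisGroup F)
    (hA : σ • ((m : ℤ) • ((m : ℤ) • A)) = (m : ℤ) • ((m : ℤ) • A)) :
    IsWeilFunction W m ((m : ℤ) • (σ • A - A)) (weilCob hm A σ) := by
  refine ⟨weilCob_ne_zero hm A σ, σ • A - A, rfl, fun P ↦ ?_⟩
  rw [weilCob, ord_transAlgHom, ord_div _ (galFunctionField_thetaFn_ne_zero hm A σ)
    (thetaFn_ne_zero hm A)]
  have hP : P + A = σ • (σ⁻¹ • (P + A)) := (smul_inv_smul σ _).symm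
  conv_lhs => rw [hP, ord_galFunctionField, ← hP]
  rw [ord_thetaFn, ord_thetaFn]
  have h1 : torsionInd W m (σ⁻¹ • (P + A) - A) = torsionInd W m (P - (σ • A - A)) := by
    rw [show σ⁻¹ • (P + A) - A = σ⁻¹ • (P + A - σ • A) by rw [smul_sub, inv_smul_smul],
      torsionInd_smul]
    congr 1
    abel
  have h2 : torsionInd W m (σ⁻¹ • (P + A)) = torsionInd W m (P + A) := torsionInd_smul _ _
  have h3 : (σ⁻¹ • (P + A) = 0) ↔ (P + A = 0) := by
    rw [inv_smul_eq_iff, smul_zero]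
  have h4 : (σ⁻¹ • (P + A) = (m : ℤ) • ((m : ℤ) • A)) ↔ (P + A = (m : ℤ) • ((m : ℤ) • A)) := by
    rw [inv_smul_eq_iff, hA]
  have h5 : torsionInd W m (P + A - A) = torsionInd W m P := by rw [add_sub_cancel_right]
  simp only [h1, h2, h3, h4, h5]
  ring

/-- **The cocycle identity of the `g_σ`**: `g_{στ} = g_σ · τ_{-(σA - A)}^* (σ̃ g_τ)` (exactly, for
the normalisation through `Ψ_A`; from `σ̃ ∘ τ_T^* = τ_{σT}^* ∘ σ̃`, `τ_S^* τ_T^* = τ_{S+T}^*` and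
`(στ)^~ = σ̃ τ̃`). [folklore] -/
theorem weilCob_mul (A : W.geomPoints) (σ τ : Field.absoluteGaloisGroup F) :
    weilCob hm A (σ * τ) =
      weilCob hm A σ * W.transAlgHom (-(σ • A - A)) (W.galFunctionField σ (weilCob hm A τ)) := by
  unfold weilCob
  rw [galFunctionField_transAlgHom, transAlgHom_transAlgHom, show -(σ • A - A) + σ • A = A by abel,
    map_div₀ (W.galFunctionField σ), ← galFunctionField_mul, ← map_mul]
  congr 1
  have h1 := galFunctionField_thetaFn_ne_zero hm A σ
  have h2 := thetaFn_ne_zero hm A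
  field_simp

end Theta

/-! ### The coboundary identity for the cup product of two Kummer cocycles -/

section MainIdentity

variable {W} {m : ℕ} [W.IsElliptic] (hm : (m : F) ≠ 0)
include hm

/-- Values of the Weil pairing function are non-zero (they are `m`-th roots of unity). [folklore] -/
theorem weilPairingFun_ne_zero {S T : W.geomPoints} (hS : (m : ℤ) • S = 0)
    (hT : (m : ℤ) • T = 0) : weilPairingFun hm S T ≠ 0 := fun h0 ↦ by
  have h := weilPairingFun_pow hm hS hT
  have hm0 : m ≠ 0 := fun h ↦ hm (by rw [h, Nat.cast_zero])
  rw [h0, zero_pow hm0] at h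
  exact zero_ne_one h

/-- `e(S, T) · e(-S, T) = 1`. [folklore] -/
theorem weilPairingFun_mul_neg_left {S T : W.geomPoints} (hS : (m : ℤ) • S = 0)
    (hT : (m : ℤ) • T = 0) : weilPairingFun hm S T * weilPairingFun hm (-S) T = 1 := by
  have hnS : (m : ℤ) • (-S) = 0 := by rw [smul_neg, hS, neg_zero]
  rw [← weilPairingFun_add_left hm hS hnS hT, add_neg_cancel, weilPairingFun_zero_left hm hT]

omit [W.IsElliptic] hm in
/-- `m (σP - P) = O` when `m P` is rational. [folklore] -/
theorem zsmul_smul_sub_eq_zero {P : W.geomPoints}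
    (hP : (m : ℤ) • P ∈ MulAction.fixedPoints (Field.absoluteGaloisGroup F) W.geomPoints)
    (σ : Field.absoluteGaloisGroup F) : (m : ℤ) • (σ • P - P) = 0 := by
  rw [smul_sub, ← smul_zsmul_geomPoints W (m : ℤ) σ P, hP σ, sub_self]

omit [W.IsElliptic] hm in
/-- `m (σQ - Q) = σ(mQ) - mQ`. [folklore] -/
theorem zsmul_smul_sub (σ : Field.absoluteGaloisGroup F) (Q : W.geomPoints) :
    (m : ℤ) • (σ • Q - Q) = σ • ((m : ℤ) • Q) - (m : ℤ) • Q := by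
  rw [smul_sub, ← smul_zsmul_geomPoints W (m : ℤ) σ Q]

omit [W.IsElliptic] hm in
/-- The cocycle relation `(στ)Q - Q = (σQ - Q) + σ(τQ - Q)`. [folklore] -/
theorem mul_smul_sub_eq (σ τ : Field.absoluteGaloisGroup F) (Q : W.geomPoints) :
    (σ * τ) • Q - Q = (σ • Q - Q) + σ • (τ • Q - Q) := by
  rw [mul_smul, smul_sub]
  abel

/-- `g_σ = weilCob Q₂ σ` is a Weil function for `t_σ = σ(mQ₂) - mQ₂`, if `m²Q₂` is rational.
[folklore] -/
theorem isWeilFunction_weilCob_root {Q₂ : W.geomPoints}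
    (hQ : (m : ℤ) • ((m : ℤ) • Q₂) ∈ MulAction.fixedPoints (Field.absoluteGaloisGroup F) W.geomPoints)
    (σ : Field.absoluteGaloisGroup F) :
    IsWeilFunction W m (σ • ((m : ℤ) • Q₂) - (m : ℤ) • Q₂) (weilCob hm Q₂ σ) := by
  have h := isWeilFunction_weilCob hm Q₂ σ (hQ σ)
  rwa [zsmul_smul_sub] at h

omit hm [W.IsElliptic] in
/-- `σ` fixes `m²(P₁ + Q₂)` if `mP₁` and `m²Q₂` are rational. [folklore] -/
theorem smul_zsmul_zsmul_add {P₁ Q₂ : W.geomPoints}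
    (hP : (m : ℤ) • P₁ ∈ MulAction.fixedPoints (Field.absoluteGaloisGroup F) W.geomPoints)
    (hQ : (m : ℤ) • ((m : ℤ) • Q₂) ∈ MulAction.fixedPoints (Field.absoluteGaloisGroup F) W.geomPoints)
    (σ : Field.absoluteGaloisGroup F) :
    σ • ((m : ℤ) • ((m : ℤ) • (P₁ + Q₂))) = (m : ℤ) • ((m : ℤ) • (P₁ + Q₂)) := by
  have h1 : σ • ((m : ℤ) • ((m : ℤ) • P₁)) = (m : ℤ) • ((m : ℤ) • P₁) := by
    rw [smul_zsmul_geomPoints W (m : ℤ) σ, hP σ]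
  have h2 : σ • ((m : ℤ) • ((m : ℤ) • Q₂)) = (m : ℤ) • ((m : ℤ) • Q₂) := hQ σ
  rw [smul_add, smul_add, smul_add, h1, h2]

/-- `h_σ = weilCob (P₁ + Q₂) σ` is a Weil function for the same `t_σ` (since `mP₁` is rational),
with root `(σP₁ - P₁) + (σQ₂ - Q₂)`. [folklore] -/
theorem isWeilFunction_weilCob_add_root {P₁ Q₂ : W.geomPoints}
    (hP : (m : ℤ) • P₁ ∈ MulAction.fixedPoints (Field.absoluteGaloisGroup F) W.geomPoints)
    (hQ : (m : ℤ) • ((m : ℤ) • Q₂) ∈ MulAction.fixedPoints (Field.absoluteGaloisGroup F) W.geomPoints)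
    (σ : Field.absoluteGaloisGroup F) :
    IsWeilFunction W m (σ • ((m : ℤ) • Q₂) - (m : ℤ) • Q₂) (weilCob hm (P₁ + Q₂) σ) := by
  have h := isWeilFunction_weilCob hm (P₁ + Q₂) σ (smul_zsmul_zsmul_add hP hQ σ)
  have e : (m : ℤ) • (σ • (P₁ + Q₂) - (P₁ + Q₂)) = σ • ((m : ℤ) • Q₂) - (m : ℤ) • Q₂ := by
    rw [show σ • (P₁ + Q₂) - (P₁ + Q₂) = (σ • P₁ - P₁) + (σ • Q₂ - Q₂) by rw [smul_add]; abel,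
      smul_add, zsmul_smul_sub_eq_zero hP, zero_add, zsmul_smul_sub]
  rwa [e] at h

/-- **The comparison constants exist**: `h_σ = u_σ · g_σ`, two Weil functions for the same point
being proportional (`IsWeilFunction.exists_eq_mul`). [folklore] -/
theorem exists_cobConst {P₁ Q₂ : W.geomPoints}
    (hP : (m : ℤ) • P₁ ∈ MulAction.fixedPoints (Field.absoluteGaloisGroup F) W.geomPoints)
    (hQ : (m : ℤ) • ((m : ℤ) • Q₂) ∈ MulAction.fixedPoints (Field.absoluteGaloisGroup F) W.geomPoints)
    (σ : Field.absoluteGaloisGroup F) :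
    ∃ a : AlgebraicClosure F, a ≠ 0 ∧ weilCob hm (P₁ + Q₂) σ =
      algebraMap (AlgebraicClosure F) W.geomFunctionField a * weilCob hm Q₂ σ :=
  (isWeilFunction_weilCob_root hm hQ σ).exists_eq_mul (isWeilFunction_weilCob_add_root hm hP hQ σ)

/-- **The comparison constant `u_σ ∈ F̄^×`** with `h_σ = u_σ g_σ`. [folklore] -/
def cobConst {P₁ Q₂ : W.geomPoints}
    (hP : (m : ℤ) • P₁ ∈ MulAction.fixedPoints (Field.absoluteGaloisGroup F) W.geomPoints)
    (hQ : (m : ℤ) • ((m : ℤ) • Q₂) ∈ MulAction.fixedPoints (Field.absoluteGaloisGroup F) W.geomPoints)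
    (σ : Field.absoluteGaloisGroup F) : AlgebraicClosure F :=
  (exists_cobConst hm hP hQ σ).choose

/-- `u_σ ≠ 0`. [folklore] -/
theorem cobConst_ne_zero {P₁ Q₂ : W.geomPoints}
    (hP : (m : ℤ) • P₁ ∈ MulAction.fixedPoints (Field.absoluteGaloisGroup F) W.geomPoints)
    (hQ : (m : ℤ) • ((m : ℤ) • Q₂) ∈ MulAction.fixedPoints (Field.absoluteGaloisGroup F) W.geomPoints)
    (σ : Field.absoluteGaloisGroup F) : cobConst hm hP hQ σ ≠ 0 :=
  (exists_cobConst hm hP hQ σ).choose_spec.1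

/-- `h_σ = u_σ · g_σ`. [folklore] -/
theorem weilCob_add_eq {P₁ Q₂ : W.geomPoints}
    (hP : (m : ℤ) • P₁ ∈ MulAction.fixedPoints (Field.absoluteGaloisGroup F) W.geomPoints)
    (hQ : (m : ℤ) • ((m : ℤ) • Q₂) ∈ MulAction.fixedPoints (Field.absoluteGaloisGroup F) W.geomPoints)
    (σ : Field.absoluteGaloisGroup F) :
    weilCob hm (P₁ + Q₂) σ =
      algebraMap (AlgebraicClosure F) W.geomFunctionField (cobConst hm hP hQ σ) * weilCob hm Q₂ σ :=
  (exists_cobConst hm hP hQ σ).choose_spec.2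

/-- **The coboundary identity.** For `σ, τ ∈ Γ_F`, with `s_σ = σP₁ - P₁`, `t_τ = τ(mQ₂) - mQ₂`
(the Kummer cocycles of `mP₁` and `m(mQ₂)` at the roots `P₁`, `mQ₂`) and the constants `u`:

  `e_m(s_σ, σ t_τ) · u_{στ} = u_σ · σ(u_τ)`,

i.e. the cup-product cocycle `(σ, τ) ↦ e_m(s_σ, σ t_τ)` is the coboundary of `u`. This is the
cocycle computation behind Poonen–Rains 2012, Prop. 4.8 with Cor. 4.6 (Zarhin's identity for
the Heisenberg group), carried out with Silverman's Weil functions.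
[cite: PoonenRains2012, Prop. 4.8 and Cor. 4.6] -/
theorem weilPairingFun_mul_cobConst {P₁ Q₂ : W.geomPoints}
    (hP : (m : ℤ) • P₁ ∈ MulAction.fixedPoints (Field.absoluteGaloisGroup F) W.geomPoints)
    (hQ : (m : ℤ) • ((m : ℤ) • Q₂) ∈ MulAction.fixedPoints (Field.absoluteGaloisGroup F) W.geomPoints)
    (σ τ : Field.absoluteGaloisGroup F) :
    weilPairingFun hm (σ • P₁ - P₁) (σ • (τ • ((m : ℤ) • Q₂) - (m : ℤ) • Q₂)) *
        cobConst hm hP hQ (σ * τ) =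
      cobConst hm hP hQ σ * σ • cobConst hm hP hQ τ := by
  -- raw forms of the cocycle identities (before abbreviations)
  have hBg := weilCob_mul hm Q₂ σ τ
  have hBh := weilCob_mul hm (P₁ + Q₂) σ τ
  have eneg : -(σ • (P₁ + Q₂) - (P₁ + Q₂)) = -(σ • P₁ - P₁) + -(σ • Q₂ - Q₂) := by
    rw [smul_add]; abel
  rw [eneg, ← transAlgHom_transAlgHom] at hBh
  have hhu : ∀ ρ, weilCob hm (P₁ + Q₂) ρ = algebraMap (AlgebraicClosure F) W.geomFunctionField
      (cobConst hm hP hQ ρ) * weilCob hm Q₂ ρ := fun ρ ↦ weilCob_add_eq hm hP hQ ρ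
  have htmul : (σ * τ) • ((m : ℤ) • Q₂) - (m : ℤ) • Q₂ =
      (σ • ((m : ℤ) • Q₂) - (m : ℤ) • Q₂) + σ • (τ • ((m : ℤ) • Q₂) - (m : ℤ) • Q₂) :=
    mul_smul_sub_eq σ τ _
  have hgW : ∀ ρ, IsWeilFunction W m (ρ • ((m : ℤ) • Q₂) - (m : ℤ) • Q₂) (weilCob hm Q₂ ρ) :=
    fun ρ ↦ isWeilFunction_weilCob_root hm hQ ρ
  have ht0 : ∀ ρ : Field.absoluteGaloisGroup F, (m : ℤ) • (ρ • ((m : ℤ) • Q₂) - (m : ℤ) • Q₂) = 0 :=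
    fun ρ ↦ by rw [smul_sub, ← smul_zsmul_geomPoints W (m : ℤ) ρ, hQ ρ, sub_self]
  -- notation
  set C := algebraMap (AlgebraicClosure F) W.geomFunctionField with hC
  set s : W.geomPoints := σ • P₁ - P₁ with hs
  set x : W.geomPoints := σ • Q₂ - Q₂ with hx
  set t : Field.absoluteGaloisGroup F → W.geomPoints :=
    fun ρ ↦ ρ • ((m : ℤ) • Q₂) - (m : ℤ) • Q₂ with ht
  set g : Field.absoluteGaloisGroup F → W.geomFunctionField := fun ρ ↦ weilCob hm Q₂ ρ with hg
  set h : Field.absoluteGaloisGroup F → W.geomFunctionField :=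
    fun ρ ↦ weilCob hm (P₁ + Q₂) ρ with hh
  set u : Field.absoluteGaloisGroup F → AlgebraicClosure F := fun ρ ↦ cobConst hm hP hQ ρ with hu
  change g (σ * τ) = g σ * W.transAlgHom (-x) (W.galFunctionField σ (g τ)) at hBg
  change h (σ * τ) = h σ * W.transAlgHom (-s) (W.transAlgHom (-x) (W.galFunctionField σ (h τ)))
    at hBh
  change ∀ ρ, h ρ = C (u ρ) * g ρ at hhu
  change t (σ * τ) = t σ + σ • t τ at htmul
  change ∀ ρ, IsWeilFunction W m (t ρ) (g ρ) at hgW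
  change ∀ ρ, (m : ℤ) • t ρ = 0 at ht0
  change weilPairingFun hm s (σ • t τ) * u (σ * τ) = u σ * σ • u τ
  -- torsion bookkeeping
  have hs0 : (m : ℤ) • s = 0 := zsmul_smul_sub_eq_zero hP σ
  have hns0 : (m : ℤ) • (-s) = 0 := by rw [smul_neg, hs0, neg_zero]
  have hσt0 : (m : ℤ) • (σ • t τ) = 0 := by
    rw [← smul_zsmul_geomPoints W (m : ℤ) σ, ht0 τ, smul_zero]
  have hg0 : ∀ ρ, g ρ ≠ 0 := fun ρ ↦ weilCob_ne_zero hm Q₂ ρ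
  -- the key function `k` and its translate by `-s`
  set k : W.geomFunctionField := W.transAlgHom (-x) (W.galFunctionField σ (g τ)) with hk
  set e₁ := weilPairingFun hm (-s) (t (σ * τ)) with he₁
  set e₂ := weilPairingFun hm (-s) (t σ) with he₂
  have hE1 : W.transAlgHom (-s) (g (σ * τ)) = C e₁ * g (σ * τ) :=
    (hgW (σ * τ)).transAlgHom_eq hm hns0 (ht0 _)
  have hE2 : W.transAlgHom (-s) (g σ) = C e₂ * g σ := (hgW σ).transAlgHom_eq hm hns0 (ht0 _)
  have hE5 : C e₂ * g σ * W.transAlgHom (-s) k = C e₁ * (g σ * k) := by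
    rw [← hBg, ← hE1, hBg, map_mul, hE2]
  -- `h (στ)` computed in two ways
  have hway1 : h (σ * τ) = C (u (σ * τ)) * (g σ * k) := by rw [hhu, hBg]
  have hway2 : h (σ * τ) = C (u σ) * g σ * (C (σ • u τ) * W.transAlgHom (-s) k) := by
    rw [hBh, hhu σ, hhu τ, map_mul, galFunctionField_algebraMap_base, galRingHom_apply, map_mul,
      AlgHom.commutes, map_mul, AlgHom.commutes]
  have hprod : C (e₂ * u (σ * τ)) * (g σ * k) = C (u σ * σ • u τ * e₁) * (g σ * k) := by
    have e := congrArg (fun z ↦ C e₂ * z) (hway1.symm.trans hway2)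
    calc C (e₂ * u (σ * τ)) * (g σ * k) = C e₂ * (C (u (σ * τ)) * (g σ * k)) := by
          rw [map_mul]; ring
      _ = C e₂ * (C (u σ) * g σ * (C (σ • u τ) * W.transAlgHom (-s) k)) := e
      _ = C (u σ) * C (σ • u τ) * (C e₂ * g σ * W.transAlgHom (-s) k) := by ring
      _ = C (u σ) * C (σ • u τ) * (C e₁ * (g σ * k)) := by rw [hE5]
      _ = C (u σ * σ • u τ * e₁) * (g σ * k) := by rw [map_mul, map_mul]; ring
  have hgk0 : g σ * k ≠ 0 := by
    refine mul_ne_zero (hg0 σ) ?_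
    exact (map_ne_zero_iff _ (W.transAlgHom (-x)).injective).mpr
      ((map_ne_zero_iff _ (W.galFunctionField σ).injective).mpr (hg0 τ))
  have hconst : e₂ * u (σ * τ) = u σ * σ • u τ * e₁ := algebraMap_mul_cancel hgk0 hprod
  -- `e₁ = e₂ · e(-s, σ t_τ)` and `e(s, ·) e(-s, ·) = 1`
  have he12 : e₁ = e₂ * weilPairingFun hm (-s) (σ • t τ) := by
    rw [he₁, htmul, weilPairingFun_add_right hm hns0 (ht0 σ) hσt0]
  have he2ne : e₂ ≠ 0 := weilPairingFun_ne_zero hm hns0 (ht0 σ)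
  have hu' : u (σ * τ) = u σ * σ • u τ * weilPairingFun hm (-s) (σ • t τ) := by
    apply mul_left_cancel₀ he2ne
    rw [hconst, he12]; ring
  have hinv := weilPairingFun_mul_neg_left hm hs0 hσt0
  rw [hu']
  calc weilPairingFun hm s (σ • t τ) * (u σ * σ • u τ * weilPairingFun hm (-s) (σ • t τ))
        = u σ * σ • u τ * (weilPairingFun hm s (σ • t τ) * weilPairingFun hm (-s) (σ • t τ)) := by
          ring
    _ = u σ * σ • u τ := by rw [hinv, mul_one]

end MainIdentity

/-! ### Local constancy and normalisation of the comparison constants -/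

section Normalisation

variable {W} {m : ℕ} [W.IsElliptic] (hm : (m : F) ≠ 0)
include hm

/-- `σ ↦ g_σ = weilCob A σ` is locally constant (it is a fixed function of `σ̃ Ψ_A`). [folklore] -/
theorem isLocallyConstant_weilCob (A : W.geomPoints) :
    IsLocallyConstant fun σ : Field.absoluteGaloisGroup F ↦ weilCob hm A σ :=
  (isLocallyConstant_galFunctionField W (thetaFn hm A)).comp
    fun z ↦ W.transAlgHom A (z / thetaFn hm A)

/-- **`σ ↦ u_σ` is locally constant**: `u_σ` is determined by the pair `(g_σ, h_σ)` (cancellation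
of the non-zero function `g_σ`), and both are locally constant in `σ`. [folklore] -/
theorem isLocallyConstant_cobConst {P₁ Q₂ : W.geomPoints}
    (hP : (m : ℤ) • P₁ ∈ MulAction.fixedPoints (Field.absoluteGaloisGroup F) W.geomPoints)
    (hQ : (m : ℤ) • ((m : ℤ) • Q₂) ∈ MulAction.fixedPoints (Field.absoluteGaloisGroup F) W.geomPoints) :
    IsLocallyConstant fun σ : Field.absoluteGaloisGroup F ↦ cobConst hm hP hQ σ := by
  have hpair := (isLocallyConstant_weilCob hm Q₂).prodMk (isLocallyConstant_weilCob hm (P₁ + Q₂))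
  rw [IsLocallyConstant.iff_exists_open] at hpair ⊢
  intro σ₀
  obtain ⟨U, hU, hσ₀, hconst⟩ := hpair σ₀
  refine ⟨U, hU, hσ₀, fun σ hσ ↦ ?_⟩
  have h := hconst σ hσ
  simp only [Prod.mk.injEq] at h
  obtain ⟨h1, h2⟩ := h
  have e1 := weilCob_add_eq hm hP hQ σ
  rw [h1, h2, weilCob_add_eq hm hP hQ σ₀] at e1
  exact (algebraMap_mul_cancel (weilCob_ne_zero hm Q₂ σ₀) e1).symm

omit [W.IsElliptic] hm in
/-- `σ ↦ σ • y` is locally constant on `Γ_F` for `y ∈ F̄` (the stabiliser of `y` is a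
neighbourhood of `1`, `setOf_smul_eq_mem_nhds_one`). [folklore] -/
theorem isLocallyConstant_smul_algebraicClosure (y : AlgebraicClosure F) :
    IsLocallyConstant fun σ : Field.absoluteGaloisGroup F ↦ σ • y := by
  refine (IsLocallyConstant.iff_exists_open _).mpr fun σ₀ ↦ ?_
  obtain ⟨U, hUsub, hUopen, hU1⟩ := mem_nhds_iff.mp
    (Literature.NumberTheory.GaloisRepresentations.setOf_smul_eq_mem_nhds_one F y)
  refine ⟨(fun σ ↦ σ₀⁻¹ * σ) ⁻¹' U, hUopen.preimage (continuous_const.mul continuous_id), ?_,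
    fun σ hσ ↦ ?_⟩
  · change σ₀⁻¹ * σ₀ ∈ U
    rwa [inv_mul_cancel]
  · have h : (σ₀⁻¹ * σ) • y = y := hUsub hσ
    calc σ • y = (σ₀ * (σ₀⁻¹ * σ)) • y := by rw [mul_inv_cancel_left]
      _ = σ₀ • y := by rw [mul_smul, h]

/-- **Normalisation of the comparison constants to `μ_m` (Hilbert 90).** There is a locally
constant `b : Γ_F → μ_m(F̄)` with `e_m(s_σ, σ t_τ) · b(στ) = b(σ) · σ b(τ)` for all `σ, τ`:
since `(∂u)^m = 1`, `σ ↦ u_σ^m` is a locally constant `1`-cocycle with values in `F̄^×`, hence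
`u_σ^m = σλ/λ` (Hilbert 90, `AlgEquiv.exists_smul_div_eq_of_isOpen`); with `λ₁^m = λ` the
cochain `b(σ) = u_σ λ₁ / σλ₁` is `μ_m`-valued and `∂b = ∂u`. [folklore] -/
theorem exists_mu_coboundary {P₁ Q₂ : W.geomPoints}
    (hP : (m : ℤ) • P₁ ∈ MulAction.fixedPoints (Field.absoluteGaloisGroup F) W.geomPoints)
    (hQ : (m : ℤ) • ((m : ℤ) • Q₂) ∈ MulAction.fixedPoints (Field.absoluteGaloisGroup F) W.geomPoints) :
    ∃ b : Field.absoluteGaloisGroup F → AlgebraicClosure F, IsLocallyConstant b ∧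
      (∀ σ, b σ ^ m = 1) ∧ ∀ σ τ : Field.absoluteGaloisGroup F,
        weilPairingFun hm (σ • P₁ - P₁) (σ • (τ • ((m : ℤ) • Q₂) - (m : ℤ) • Q₂)) * b (σ * τ) =
          b σ * σ • b τ := by
  set u : Field.absoluteGaloisGroup F → AlgebraicClosure F := fun ρ ↦ cobConst hm hP hQ ρ with hu
  have hu0 : ∀ ρ, u ρ ≠ 0 := fun ρ ↦ cobConst_ne_zero hm hP hQ ρ
  have hulc : IsLocallyConstant u := isLocallyConstant_cobConst hm hP hQ
  have hI : ∀ σ τ : Field.absoluteGaloisGroup F,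
      weilPairingFun hm (σ • P₁ - P₁) (σ • (τ • ((m : ℤ) • Q₂) - (m : ℤ) • Q₂)) * u (σ * τ) =
        u σ * σ • u τ := fun σ τ ↦ weilPairingFun_mul_cobConst hm hP hQ σ τ
  have hm0 : m ≠ 0 := fun h ↦ hm (by rw [h, Nat.cast_zero])
  -- the cup-product values are `m`-th roots of unity
  have hepow : ∀ σ τ : Field.absoluteGaloisGroup F,
      weilPairingFun hm (σ • P₁ - P₁) (σ • (τ • ((m : ℤ) • Q₂) - (m : ℤ) • Q₂)) ^ m = 1 := by
    intro σ τ
    refine weilPairingFun_pow hm (zsmul_smul_sub_eq_zero hP σ) ?_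
    rw [← smul_zsmul_geomPoints W (m : ℤ) σ, smul_sub, ← smul_zsmul_geomPoints W (m : ℤ) τ, hQ τ,
      sub_self, smul_zero]
  -- `σ ↦ u_σ^m` as a units-valued cocycle
  let Φ : AlgebraicClosure F → (AlgebraicClosure F)ˣ := fun a ↦
    if ha : a = 0 then 1 else Units.mk0 a ha ^ m
  set f : Field.absoluteGaloisGroup F → (AlgebraicClosure F)ˣ := fun ρ ↦ Φ (u ρ) with hf
  have hfval : ∀ ρ, ((f ρ : (AlgebraicClosure F)ˣ) : AlgebraicClosure F) = u ρ ^ m := fun ρ ↦ by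
    simp only [hf, Φ, dif_neg (hu0 ρ), Units.val_pow_eq_pow_val, Units.val_mk0]
  have hflc : IsLocallyConstant f := hulc.comp Φ
  have hsm : ∀ (g : Field.absoluteGaloisGroup F) (z : (AlgebraicClosure F)ˣ),
      ((g • z : (AlgebraicClosure F)ˣ) : AlgebraicClosure F) = g • (z : AlgebraicClosure F) :=
    fun g z ↦ rfl
  have hfcoc : ∀ g h : Field.absoluteGaloisGroup F, f (g * h) = g • f h * f g := by
    intro g h
    apply Units.ext
    rw [Units.val_mul, hsm, hfval, hfval, hfval, smul_pow']
    have e := congrArg (fun z ↦ z ^ m) (hI g h)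
    simp only [mul_pow, hepow, one_mul] at e
    rw [e, mul_comm]
  have hopen : IsOpen {g : Field.absoluteGaloisGroup F | f g = 1} := hflc.isOpen_fiber 1
  obtain ⟨x, hx⟩ := Literature.NumberTheory.GaloisRepresentations.AlgEquiv.exists_smul_div_eq_of_isOpen
    (K := F) (L := AlgebraicClosure F) f hfcoc hopen
  have hxval : ∀ g : Field.absoluteGaloisGroup F,
      g • ((x : (AlgebraicClosure F)ˣ) : AlgebraicClosure F) / x = u g ^ m := fun g ↦ by
    have e := congrArg (fun z : (AlgebraicClosure F)ˣ ↦ (z : AlgebraicClosure F)) (hx g)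
    simp only [Units.val_div_eq_div_val, hfval] at e
    rw [← e, AlgEquiv.smul_units_def, Units.coe_map, MonoidHom.coe_coe]
    rfl
  have hx0 : ((x : (AlgebraicClosure F)ˣ) : AlgebraicClosure F) ≠ 0 := x.ne_zero
  -- an `m`-th root `y` of `x`
  obtain ⟨y, hy⟩ := IsAlgClosed.exists_pow_nat_eq ((x : (AlgebraicClosure F)ˣ) : AlgebraicClosure F)
    (Nat.pos_of_ne_zero hm0)
  have hy0 : y ≠ 0 := fun h0 ↦ hx0 (by rw [← hy, h0, zero_pow hm0])
  have hgy0 : ∀ g : Field.absoluteGaloisGroup F, g • y ≠ 0 := fun g h0 ↦ hy0 (by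
    rw [smul_eq_zero_iff_eq] at h0
    exact h0)
  have hgx0 : ∀ g : Field.absoluteGaloisGroup F,
      g • ((x : (AlgebraicClosure F)ˣ) : AlgebraicClosure F) ≠ 0 := fun g h0 ↦ hx0 (by
    rw [smul_eq_zero_iff_eq] at h0
    exact h0)
  refine ⟨fun g ↦ u g * y / g • y, ?_, fun g ↦ ?_, fun g h ↦ ?_⟩
  · exact (hulc.prodMk (isLocallyConstant_smul_algebraicClosure y)).comp
      fun p : AlgebraicClosure F × AlgebraicClosure F ↦ p.1 * y / p.2
  · have hxg := hxval g
    have hgx := hgx0 g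
    rw [div_pow, mul_pow, ← smul_pow', hy, ← hxval g]
    field_simp
  · have e := hI g h
    have hgy := hgy0 g
    have hghy : g • h • y ≠ 0 := by rw [← mul_smul]; exact hgy0 (g * h)
    beta_reduce
    rw [mul_smul]
    have h1 : g • (u h * y / h • y) = g • u h * g • y / g • h • y := by
      rw [div_eq_mul_inv, div_eq_mul_inv, smul_mul', smul_mul', smul_inv'']
    rw [h1]
    calc weilPairingFun hm (g • P₁ - P₁) (g • (h • ((m : ℤ) • Q₂) - (m : ℤ) • Q₂)) *
          (u (g * h) * y / g • h • y)
          = (weilPairingFun hm (g • P₁ - P₁) (g • (h • ((m : ℤ) • Q₂) - (m : ℤ) • Q₂)) *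
              u (g * h)) * y / g • h • y := by ring
      _ = u g * g • u h * y / g • h • y := by rw [e]
      _ = u g * g • u h * y * g • y / (g • h • y * g • y) := (mul_div_mul_right _ _ hgy).symm
      _ = u g * y / g • y * (g • u h * g • y / g • h • y) := by
          rw [div_mul_div_comm]; ring

end Normalisation

/-! ### `E[m] = ⟨P₀, Q₀⟩` with `e_m(P₀, Q₀)` primitive; alternating pairings are powers of `e_m` -/

section Structure

variable {W} {m : ℕ} [W.IsElliptic] (hm : (m : F) ≠ 0)
include hm

omit [W.IsElliptic] hm in
/-- Elements of `E[m]` are `m`-torsion geometric points. [folklore] -/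
theorem zsmul_coe_geomTorsion (S : geomTorsion W m) : (m : ℤ) • (S : W.geomPoints) = 0 :=
  (mem_torsionPoints_iff _ _ (S : W.geomPoints)).mp S.2

/-- `e(S, O) = 1`. [folklore] -/
theorem weilPairingFun_zero_right {S : W.geomPoints} (hS : (m : ℤ) • S = 0) :
    weilPairingFun hm S 0 = 1 := by
  have h := weilPairingFun_add_right hm hS (smul_zero _) (smul_zero _)
  rw [add_zero] at h
  have hne := weilPairingFun_ne_zero hm hS (smul_zero (m : ℤ))
  calc weilPairingFun hm S 0 = weilPairingFun hm S 0 * weilPairingFun hm S 0 * (weilPairingFun hm S 0)⁻¹ := by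
        rw [mul_assoc, mul_inv_cancel₀ hne, mul_one]
    _ = 1 := by rw [← h, mul_inv_cancel₀ hne]

/-- `e(S, n • T) = e(S, T)ⁿ`. [folklore] -/
theorem weilPairingFun_nsmul_right {S T : W.geomPoints} (hS : (m : ℤ) • S = 0)
    (hT : (m : ℤ) • T = 0) (n : ℕ) :
    weilPairingFun hm S (n • T) = weilPairingFun hm S T ^ n := by
  induction n with
  | zero => rw [zero_nsmul, pow_zero, weilPairingFun_zero_right hm hS]
  | succ n ih =>
    have hnT : (m : ℤ) • (n • T) = 0 := by rw [← natCast_zsmul, smul_comm, hT, smul_zero]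
    rw [succ_nsmul, weilPairingFun_add_right hm hS hnT hT, ih, pow_succ]

/-- **Skew-symmetry**: `e(S, T) · e(T, S) = 1` (expand `e(S + T, S + T) = 1`). Silverman, *AEC*,
Prop. III.8.1(b) (consequence). [cite: SilvermanAEC2009, Prop. III.8.1(b)] -/
theorem weilPairingFun_mul_comm_eq_one {S T : W.geomPoints} (hS : (m : ℤ) • S = 0)
    (hT : (m : ℤ) • T = 0) : weilPairingFun hm S T * weilPairingFun hm T S = 1 := by
  have hST : (m : ℤ) • (S + T) = 0 := by rw [smul_add, hS, hT, add_zero]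
  have h := weilPairingFun_self hm hST
  rw [weilPairingFun_add_left hm hS hT hST, weilPairingFun_add_right hm hS hS hT,
    weilPairingFun_add_right hm hT hS hT, weilPairingFun_self hm hS, weilPairingFun_self hm hT,
    one_mul, mul_one] at h
  exact h

/-- **Non-degeneracy in the first variable**: if `e(S, T) = 1` for all `T ∈ E[m]` then `S = O`
(from non-degeneracy in the second variable and skew-symmetry). Silverman, *AEC*,
Prop. III.8.1(c). [cite: SilvermanAEC2009, Prop. III.8.1(c)] -/
theorem eq_zero_of_weilPairingFun_eq_one_left {S : W.geomPoints} (hS : (m : ℤ) • S = 0)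
    (h1 : ∀ T : W.geomPoints, (m : ℤ) • T = 0 → weilPairingFun hm S T = 1) : S = 0 :=
  eq_zero_of_weilPairingFun_eq_one hm hS fun T hT ↦ by
    have h := weilPairingFun_mul_comm_eq_one hm hS hT
    rwa [h1 T hT, one_mul] at h

omit [W.IsElliptic] in
/-- `m ≠ 0` in `F̄`. [folklore] -/
theorem natCast_algebraicClosure_ne_zero' : ((m : ℕ) : AlgebraicClosure F) ≠ 0 := fun h ↦ hm (by
  have : algebraMap F (AlgebraicClosure F) (m : F) = 0 := by rwa [map_natCast]
  exact (map_eq_zero _).mp this)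

/-- **`E[m]` has a point of order `m`**: the exponent `k` of `E[m]` divides `m`, and `E[m] ⊆ E[k]`
with `#E[m] = m²`, `#E[k] = k²` forces `k = m`; an abelian group has an element whose order is
the exponent. Silverman, *AEC*, Cor. III.6.4(b) (`E[m] ≅ ℤ/m × ℤ/m`).
[cite: SilvermanAEC2009, Cor. III.6.4(b)] -/
theorem exists_addOrderOf_eq : ∃ P₀ : geomTorsion W m, addOrderOf P₀ = m := by
  have hm0 : m ≠ 0 := fun h ↦ hm (by rw [h, Nat.cast_zero])
  have hmZ : (m : ℤ) ≠ 0 := intCast_ne_zero_of_natCast_ne_zero hm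
  haveI : Finite (geomTorsion W m) := finite_geomTorsion W hmZ
  obtain ⟨P₀, hP₀⟩ := AddMonoid.exists_addOrderOf_eq_exponent
    (G := geomTorsion W m) AddMonoid.ExponentExists.of_finite
  set k := AddMonoid.exponent (geomTorsion W m) with hk
  have hkm : k ∣ m := by
    refine AddMonoid.exponent_dvd_of_forall_nsmul_eq_zero fun S ↦ Subtype.ext ?_
    rw [AddSubmonoidClass.coe_nsmul, ← natCast_zsmul]
    exact zsmul_coe_geomTorsion S
  obtain ⟨l, hl⟩ := hkm
  have hk0 : k ≠ 0 := fun h ↦ hm0 (by rw [hl, h, zero_mul])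
  have hkZ : (k : ℤ) ≠ 0 := by exact_mod_cast hk0
  have hkF : ((k : ℕ) : AlgebraicClosure F) ≠ 0 := fun h ↦
    natCast_algebraicClosure_ne_zero' hm (by rw [hl, Nat.cast_mul, h, zero_mul])
  haveI : Finite (geomTorsion W k) := finite_geomTorsion W hkZ
  have hcardk : Nat.card (geomTorsion W k) = k ^ 2 :=
    card_torsionPoints_eq_sq_holds W (AlgebraicClosure F) hkF
  have hcardm : Nat.card (geomTorsion W m) = m ^ 2 :=
    card_torsionPoints_eq_sq_holds W (AlgebraicClosure F) (natCast_algebraicClosure_ne_zero' hm)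
  let ι : geomTorsion W m → geomTorsion W k := fun S ↦ ⟨S.1, (mem_torsionPoints_iff _ _ S.1).mpr (by
    have h := AddMonoid.exponent_nsmul_eq_zero S
    have h' := congrArg Subtype.val h
    rw [AddSubmonoidClass.coe_nsmul, ← natCast_zsmul] at h'
    exact h')⟩
  have hι : Function.Injective ι := fun S T h ↦ Subtype.ext (by
    have h' := congrArg (fun P : geomTorsion W k ↦ (P : W.geomPoints)) h
    exact h')
  have hle : Nat.card (geomTorsion W m) ≤ Nat.card (geomTorsion W k) :=
    Nat.card_le_card_of_injective ι hι
  rw [hcardk, hcardm, Nat.pow_le_pow_iff_left two_ne_zero] at hle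
  have hkm' : k ≤ m := Nat.le_of_dvd (Nat.pos_of_ne_zero hm0) ⟨l, hl⟩
  exact ⟨P₀, by rw [hP₀]; omega⟩

/-- **Some value `e_m(P₀, Q₀)` is a primitive `m`-th root of unity**, for `P₀` of order `m`: the
values `e_m(P₀, T)`, `T ∈ E[m]`, form a finite, hence cyclic, subgroup of `F̄^×`, of order `d`
with `e_m(dP₀, ·) = 1`, so `dP₀ = O` by non-degeneracy and `m ∣ d`; a generator is a value
`e_m(P₀, Q₀)` of order `d = m`. Silverman, *AEC*, Cor. III.8.1.1.
[cite: SilvermanAEC2009, Cor. III.8.1.1] -/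
theorem exists_isPrimitiveRoot_weilPairingFun {P₀ : geomTorsion W m} (hP₀ : addOrderOf P₀ = m) :
    ∃ Q₀ : geomTorsion W m,
      IsPrimitiveRoot (weilPairingFun hm (P₀ : W.geomPoints) (Q₀ : W.geomPoints)) m := by
  have hm0 : m ≠ 0 := fun h ↦ hm (by rw [h, Nat.cast_zero])
  have hmZ : (m : ℤ) ≠ 0 := intCast_ne_zero_of_natCast_ne_zero hm
  haveI : Finite (geomTorsion W m) := finite_geomTorsion W hmZ
  have mem := zsmul_coe_geomTorsion (W := W) (m := m)
  -- the character `T ↦ e(P₀, T)` with values in `F̄ˣ`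
  let χ : Multiplicative (geomTorsion W m) →* (AlgebraicClosure F)ˣ :=
    { toFun := fun T ↦ Units.mk0
        (weilPairingFun hm (P₀ : W.geomPoints) ((Multiplicative.toAdd T : geomTorsion W m) : W.geomPoints))
        (weilPairingFun_ne_zero hm (mem P₀) (mem _))
      map_one' := Units.ext (by
        rw [Units.val_mk0, Units.val_one, toAdd_one, ZeroMemClass.coe_zero,
          weilPairingFun_zero_right hm (mem P₀)])
      map_mul' := fun a b ↦ Units.ext (by
        rw [Units.val_mul, Units.val_mk0, Units.val_mk0, Units.val_mk0, toAdd_mul,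
          AddSubmonoid.coe_add, weilPairingFun_add_right hm (mem P₀) (mem _) (mem _)]) }
  have hχ : ∀ T : geomTorsion W m, ((χ (Multiplicative.ofAdd T) : (AlgebraicClosure F)ˣ) :
      AlgebraicClosure F) = weilPairingFun hm (P₀ : W.geomPoints) (T : W.geomPoints) := fun T ↦ rfl
  let H : Subgroup (AlgebraicClosure F)ˣ := χ.range
  haveI : Finite H := Finite.of_surjective χ.rangeRestrict χ.rangeRestrict_surjective
  obtain ⟨ζ, hζ⟩ := IsCyclic.exists_generator (α := H)
  have hord : orderOf ζ = Nat.card H := orderOf_eq_card_of_forall_mem_zpowers hζ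
  set d := orderOf ζ with hd
  -- every value is killed by `d`
  have hpowd : ∀ T : geomTorsion W m,
      weilPairingFun hm (P₀ : W.geomPoints) (T : W.geomPoints) ^ d = 1 := fun T ↦ by
    have hx : (⟨χ (Multiplicative.ofAdd T), Multiplicative.ofAdd T, rfl⟩ : H) ^ d = 1 := by
      rw [hord]; exact pow_card_eq_one'
    have hx' := congrArg (fun z : H ↦ ((z.1 : (AlgebraicClosure F)ˣ) : AlgebraicClosure F)) hx
    simpa only [SubmonoidClass.coe_pow, Units.val_pow_eq_pow_val, OneMemClass.coe_one,
      Units.val_one, hχ] using hx'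
  -- hence `d • P₀ = 0` and `m ∣ d`
  have hdP : d • P₀ = 0 := by
    apply Subtype.ext
    rw [AddSubmonoidClass.coe_nsmul, ZeroMemClass.coe_zero]
    refine eq_zero_of_weilPairingFun_eq_one_left hm ?_ fun T hT ↦ ?_
    · rw [← natCast_zsmul, smul_comm, mem P₀, smul_zero]
    · rw [weilPairingFun_nsmul_left hm (mem P₀) hT d]
      exact hpowd ⟨T, (mem_torsionPoints_iff _ _ T).mpr hT⟩
  have hmd : m ∣ d := by
    rw [← hP₀]
    exact addOrderOf_dvd_of_nsmul_eq_zero hdP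
  -- `ζ` is a value `e(P₀, Q₀)`, so `d ∣ m`
  obtain ⟨x₀, hx₀⟩ := MonoidHom.mem_range.mp ζ.2
  have hdm : d ∣ m := by
    refine orderOf_dvd_of_pow_eq_one (Subtype.ext (Units.ext ?_))
    rw [SubmonoidClass.coe_pow, Units.val_pow_eq_pow_val, OneMemClass.coe_one, Units.val_one,
      ← hx₀, ← ofAdd_toAdd x₀, hχ]
    exact weilPairingFun_pow hm (mem P₀) (mem _)
  have hdeq : d = m := Nat.dvd_antisymm hdm hmd
  refine ⟨Multiplicative.toAdd x₀, ?_⟩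
  have h2 : orderOf ((ζ : H) : (AlgebraicClosure F)ˣ) = m := by rw [Subgroup.orderOf_coe, ← hd, hdeq]
  rw [← hχ, ofAdd_toAdd, hx₀, IsPrimitiveRoot.coe_units_iff, ← h2]
  exact IsPrimitiveRoot.orderOf _

end Structure

/-! ### Generation of `E[m]` by `P₀, Q₀`; alternating pairings are powers of the Weil pairing -/

section Generation

variable {W} {m : ℕ} [W.IsElliptic] (hm : (m : F) ≠ 0)
include hm

/-- **`E[m] = {aP₀ + bQ₀}`** when `e_m(P₀, Q₀)` is a primitive `m`-th root of unity: the map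
`(a, b) ↦ aP₀ + bQ₀` on `(ℤ/m)²` is injective (pair with `Q₀` and with `P₀`), hence bijective
(`#E[m] = m²`). Silverman, *AEC*, Cor. III.6.4(b) and Cor. III.8.1.1.
[cite: SilvermanAEC2009, Cor. III.6.4(b)] -/
theorem exists_eq_nsmul_add_nsmul {P₀ Q₀ : geomTorsion W m}
    (hprim : IsPrimitiveRoot (weilPairingFun hm (P₀ : W.geomPoints) (Q₀ : W.geomPoints)) m)
    (S : geomTorsion W m) : ∃ a b : ℕ, S = a • P₀ + b • Q₀ := by
  have hmZ : (m : ℤ) ≠ 0 := intCast_ne_zero_of_natCast_ne_zero hm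
  haveI : Finite (geomTorsion W m) := finite_geomTorsion W hmZ
  letI : Fintype (geomTorsion W m) := Fintype.ofFinite _
  have mem := zsmul_coe_geomTorsion (W := W) (m := m)
  let f : Fin m × Fin m → geomTorsion W m := fun ab ↦ (ab.1 : ℕ) • P₀ + (ab.2 : ℕ) • Q₀
  -- pairing `aP₀ + bQ₀` with `Q₀` and `P₀`
  have hvalQ : ∀ a b : ℕ, weilPairingFun hm (((a • P₀ + b • Q₀ : geomTorsion W m)) : W.geomPoints)
      (Q₀ : W.geomPoints) = weilPairingFun hm (P₀ : W.geomPoints) (Q₀ : W.geomPoints) ^ a := by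
    intro a b
    have ha : (m : ℤ) • (a • (P₀ : W.geomPoints)) = 0 := by
      rw [← natCast_zsmul, smul_comm, mem P₀, smul_zero]
    have hb : (m : ℤ) • (b • (Q₀ : W.geomPoints)) = 0 := by
      rw [← natCast_zsmul, smul_comm, mem Q₀, smul_zero]
    rw [AddSubmonoid.coe_add, AddSubmonoidClass.coe_nsmul, AddSubmonoidClass.coe_nsmul,
      weilPairingFun_add_left hm ha hb (mem Q₀), weilPairingFun_nsmul_left hm (mem P₀) (mem Q₀),
      weilPairingFun_nsmul_left hm (mem Q₀) (mem Q₀), weilPairingFun_self hm (mem Q₀), one_pow,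
      mul_one]
  have hvalP : ∀ a b : ℕ, weilPairingFun hm (P₀ : W.geomPoints)
      (((a • P₀ + b • Q₀ : geomTorsion W m)) : W.geomPoints) =
        weilPairingFun hm (P₀ : W.geomPoints) (Q₀ : W.geomPoints) ^ b := by
    intro a b
    have ha : (m : ℤ) • (a • (P₀ : W.geomPoints)) = 0 := by
      rw [← natCast_zsmul, smul_comm, mem P₀, smul_zero]
    have hb : (m : ℤ) • (b • (Q₀ : W.geomPoints)) = 0 := by
      rw [← natCast_zsmul, smul_comm, mem Q₀, smul_zero]
    rw [AddSubmonoid.coe_add, AddSubmonoidClass.coe_nsmul, AddSubmonoidClass.coe_nsmul,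
      weilPairingFun_add_right hm (mem P₀) ha hb, weilPairingFun_nsmul_right hm (mem P₀) (mem P₀),
      weilPairingFun_nsmul_right hm (mem P₀) (mem Q₀), weilPairingFun_self hm (mem P₀), one_pow,
      one_mul]
  have hinj : Function.Injective f := by
    rintro ⟨a, b⟩ ⟨a', b'⟩ h
    change (a : ℕ) • P₀ + (b : ℕ) • Q₀ = (a' : ℕ) • P₀ + (b' : ℕ) • Q₀ at h
    have h1 := congrArg (fun S : geomTorsion W m ↦ weilPairingFun hm (S : W.geomPoints)
      (Q₀ : W.geomPoints)) h
    have h2 := congrArg (fun S : geomTorsion W m ↦ weilPairingFun hm (P₀ : W.geomPoints)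
      (S : W.geomPoints)) h
    simp only [hvalQ, hvalP] at h1 h2
    have ea : (a : ℕ) = a' := hprim.pow_inj a.2 a'.2 h1
    have eb : (b : ℕ) = b' := hprim.pow_inj b.2 b'.2 h2
    exact Prod.ext (Fin.ext ea) (Fin.ext eb)
  have hcard : Fintype.card (Fin m × Fin m) = Fintype.card (geomTorsion W m) := by
    rw [Fintype.card_prod, Fintype.card_fin, ← Nat.card_eq_fintype_card,
      show Nat.card (geomTorsion W m) = m ^ 2 from
        card_torsionPoints_eq_sq_holds W (AlgebraicClosure F) (natCast_algebraicClosure_ne_zero' hm),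
      pow_two]
  have hbij : Function.Bijective f := (Fintype.bijective_iff_injective_and_card f).mpr ⟨hinj, hcard⟩
  obtain ⟨⟨a, b⟩, rfl⟩ := hbij.2 S
  exact ⟨a, b, rfl⟩

omit [W.IsElliptic] hm

/-- `ε(O, T) = 1` for a pairing additive in the first variable with non-zero values.
[folklore] -/
theorem pairing_zero_left {ε : geomTorsion W m → geomTorsion W m → AlgebraicClosure F}
    (hμ : ∀ S T, ε S T ^ m = 1) (hadd₁ : ∀ S₁ S₂ T, ε (S₁ + S₂) T = ε S₁ T * ε S₂ T)
    (hm0 : m ≠ 0) (T : geomTorsion W m) : ε 0 T = 1 := by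
  have h := hadd₁ 0 0 T
  rw [add_zero] at h
  have hne : ε 0 T ≠ 0 := fun h0 ↦ by
    have := hμ 0 T
    rw [h0, zero_pow hm0] at this
    exact zero_ne_one this
  calc ε 0 T = ε 0 T * ε 0 T * (ε 0 T)⁻¹ := by rw [mul_assoc, mul_inv_cancel₀ hne, mul_one]
    _ = 1 := by rw [← h, mul_inv_cancel₀ hne]

/-- `ε(S, O) = 1` for a pairing additive in the second variable with non-zero values.
[folklore] -/
theorem pairing_zero_right {ε : geomTorsion W m → geomTorsion W m → AlgebraicClosure F}
    (hμ : ∀ S T, ε S T ^ m = 1) (hadd₂ : ∀ S T₁ T₂, ε S (T₁ + T₂) = ε S T₁ * ε S T₂)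
    (hm0 : m ≠ 0) (S : geomTorsion W m) : ε S 0 = 1 := by
  have h := hadd₂ S 0 0
  rw [add_zero] at h
  have hne : ε S 0 ≠ 0 := fun h0 ↦ by
    have := hμ S 0
    rw [h0, zero_pow hm0] at this
    exact zero_ne_one this
  calc ε S 0 = ε S 0 * ε S 0 * (ε S 0)⁻¹ := by rw [mul_assoc, mul_inv_cancel₀ hne, mul_one]
    _ = 1 := by rw [← h, mul_inv_cancel₀ hne]

/-- `ε(n • S, T) = ε(S, T)ⁿ`. [folklore] -/
theorem pairing_nsmul_left {ε : geomTorsion W m → geomTorsion W m → AlgebraicClosure F}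
    (hμ : ∀ S T, ε S T ^ m = 1) (hadd₁ : ∀ S₁ S₂ T, ε (S₁ + S₂) T = ε S₁ T * ε S₂ T)
    (hm0 : m ≠ 0) (S T : geomTorsion W m) (n : ℕ) : ε (n • S) T = ε S T ^ n := by
  induction n with
  | zero => rw [zero_nsmul, pow_zero, pairing_zero_left hμ hadd₁ hm0]
  | succ n ih => rw [succ_nsmul, hadd₁, ih, pow_succ]

/-- `ε(S, n • T) = ε(S, T)ⁿ`. [folklore] -/
theorem pairing_nsmul_right {ε : geomTorsion W m → geomTorsion W m → AlgebraicClosure F}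
    (hμ : ∀ S T, ε S T ^ m = 1) (hadd₂ : ∀ S T₁ T₂, ε S (T₁ + T₂) = ε S T₁ * ε S T₂)
    (hm0 : m ≠ 0) (S T : geomTorsion W m) (n : ℕ) : ε S (n • T) = ε S T ^ n := by
  induction n with
  | zero => rw [zero_nsmul, pow_zero, pairing_zero_right hμ hadd₂ hm0]
  | succ n ih => rw [succ_nsmul, hadd₂, ih, pow_succ]

/-- **Skew-symmetry as a power**: `ε(T, S) = ε(S, T)^{m-1}` for an alternating biadditive
pairing with `ε^m = 1`. [folklore] -/
theorem pairing_comm_eq_pow {ε : geomTorsion W m → geomTorsion W m → AlgebraicClosure F}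
    (hμ : ∀ S T, ε S T ^ m = 1) (hadd₁ : ∀ S₁ S₂ T, ε (S₁ + S₂) T = ε S₁ T * ε S₂ T)
    (hadd₂ : ∀ S T₁ T₂, ε S (T₁ + T₂) = ε S T₁ * ε S T₂) (halt : ∀ T, ε T T = 1) (hm0 : m ≠ 0)
    (S T : geomTorsion W m) : ε T S = ε S T ^ (m - 1) := by
  have h := halt (S + T)
  rw [hadd₁, hadd₂, hadd₂, halt S, halt T, one_mul, mul_one] at h
  -- `h : ε S T * ε T S = 1`
  obtain ⟨k, hk⟩ := Nat.exists_eq_succ_of_ne_zero hm0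
  have hpow := hμ S T
  rw [hk, pow_succ'] at hpow
  calc ε T S = ε T S * (ε S T * ε S T ^ k) := by rw [hpow, mul_one]
    _ = (ε S T * ε T S) * ε S T ^ k := by ring
    _ = ε S T ^ (m - 1) := by rw [h, one_mul, hk, Nat.succ_sub_one]

/-- **Values of an alternating biadditive pairing on `⟨P₀, Q₀⟩`**:
`ε(aP₀ + bQ₀, a'P₀ + b'Q₀) = ε(P₀, Q₀)^{ab' + (m-1)a'b}`. [folklore] -/
theorem pairing_generators_eq_pow {ε : geomTorsion W m → geomTorsion W m → AlgebraicClosure F}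
    (hμ : ∀ S T, ε S T ^ m = 1) (hadd₁ : ∀ S₁ S₂ T, ε (S₁ + S₂) T = ε S₁ T * ε S₂ T)
    (hadd₂ : ∀ S T₁ T₂, ε S (T₁ + T₂) = ε S T₁ * ε S T₂) (halt : ∀ T, ε T T = 1) (hm0 : m ≠ 0)
    (P₀ Q₀ : geomTorsion W m) (a b a' b' : ℕ) :
    ε (a • P₀ + b • Q₀) (a' • P₀ + b' • Q₀) = ε P₀ Q₀ ^ (a * b' + (m - 1) * (a' * b)) := by
  rw [hadd₁, pairing_nsmul_left hμ hadd₁ hm0, pairing_nsmul_left hμ hadd₁ hm0, hadd₂, hadd₂,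
    pairing_nsmul_right hμ hadd₂ hm0, pairing_nsmul_right hμ hadd₂ hm0,
    pairing_nsmul_right hμ hadd₂ hm0, pairing_nsmul_right hμ hadd₂ hm0, halt P₀, halt Q₀,
    pairing_comm_eq_pow hμ hadd₁ hadd₂ halt hm0 P₀ Q₀, one_pow, one_mul, one_pow, mul_one,
    ← pow_mul, ← pow_mul, ← pow_mul, ← pow_add]
  congr 1
  ring

include hm in
/-- **Every alternating biadditive `μ_m`-valued pairing on `E[m]` is a power of the Weil
pairing**: `ε = e_m^c` pointwise (both are determined by their value on the generating pair
`(P₀, Q₀)`, and `ε(P₀, Q₀) ∈ μ_m = ⟨e_m(P₀, Q₀)⟩`). This is the reduction of the isotropy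
statement for an arbitrary `ε` to the Weil pairing (`Λ²E[m] ≅ ℤ/m`). Silverman, *AEC*,
Cor. III.6.4(b), Cor. III.8.1.1. [cite: SilvermanAEC2009, Cor. III.8.1.1] -/
theorem exists_pairing_eq_weilPairingFun_pow [W.IsElliptic]
    (ε : geomTorsion W m → geomTorsion W m → AlgebraicClosure F)
    (hμ : ∀ S T, ε S T ^ m = 1) (hadd₁ : ∀ S₁ S₂ T, ε (S₁ + S₂) T = ε S₁ T * ε S₂ T)
    (hadd₂ : ∀ S T₁ T₂, ε S (T₁ + T₂) = ε S T₁ * ε S T₂) (halt : ∀ T, ε T T = 1) :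
    ∃ c : ℕ, ∀ S T : geomTorsion W m,
      ε S T = weilPairingFun hm (S : W.geomPoints) (T : W.geomPoints) ^ c := by
  have hm0 : m ≠ 0 := fun h ↦ hm (by rw [h, Nat.cast_zero])
  haveI : NeZero m := ⟨hm0⟩
  have mem := zsmul_coe_geomTorsion (W := W) (m := m)
  obtain ⟨P₀, hP₀⟩ := exists_addOrderOf_eq hm (W := W)
  obtain ⟨Q₀, hprim⟩ := exists_isPrimitiveRoot_weilPairingFun hm hP₀
  obtain ⟨c, -, hc⟩ := hprim.eq_pow_of_pow_eq_one (hμ P₀ Q₀)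
  refine ⟨c, fun S T ↦ ?_⟩
  obtain ⟨a, b, rfl⟩ := exists_eq_nsmul_add_nsmul hm hprim S
  obtain ⟨a', b', rfl⟩ := exists_eq_nsmul_add_nsmul hm hprim T
  -- the Weil pairing restricted to `E[m]` as a pairing `ε₀` on the subgroup
  set ε₀ : geomTorsion W m → geomTorsion W m → AlgebraicClosure F :=
    fun S T ↦ weilPairingFun hm (S : W.geomPoints) (T : W.geomPoints) with hε₀
  have hμ₀ : ∀ S T, ε₀ S T ^ m = 1 := fun S T ↦ weilPairingFun_pow hm (mem S) (mem T)
  have hadd₁₀ : ∀ S₁ S₂ T, ε₀ (S₁ + S₂) T = ε₀ S₁ T * ε₀ S₂ T := fun S₁ S₂ T ↦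
    weilPairingFun_add_left hm (mem S₁) (mem S₂) (mem T)
  have hadd₂₀ : ∀ S T₁ T₂, ε₀ S (T₁ + T₂) = ε₀ S T₁ * ε₀ S T₂ := fun S T₁ T₂ ↦
    weilPairingFun_add_right hm (mem S) (mem T₁) (mem T₂)
  have halt₀ : ∀ T, ε₀ T T = 1 := fun T ↦ weilPairingFun_self hm (mem T)
  change ε (a • P₀ + b • Q₀) (a' • P₀ + b' • Q₀) = ε₀ (a • P₀ + b • Q₀) (a' • P₀ + b' • Q₀) ^ c
  rw [pairing_generators_eq_pow hμ hadd₁ hadd₂ halt hm0,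
    pairing_generators_eq_pow hμ₀ hadd₁₀ hadd₂₀ halt₀ hm0, ← hc, ← pow_mul, ← pow_mul, mul_comm]

end Generation


end WeierstrassCurve

/-! ### The discharge: isotropy of the Kummer image -/

namespace Literature.NumberTheory.EllipticCurves

open WeierstrassCurve Field
open Literature.NumberTheory.GaloisRepresentations
open Literature.NumberTheory.GaloisRepresentations.DiscreteGaloisModule (mu MuCarrier)

-- Cup products need `LocallyCompactSpace Γ_F`; as in `KummerImageIsotropy.lean`, the compactness of
-- absolute Galois groups is a local instance only.
attribute [local instance] absoluteGaloisGroup_compactSpace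

variable {F : Type u} [Field F]

/-- The underlying element of `F̄` of an element of the carrier `MuCarrier F n` of `μₙ`.
[folklore] -/
def muFieldVal {n : ℕ} (x : MuCarrier F n) : AlgebraicClosure F :=
  (((MuCarrier.toAdditive x).toMul : rootsOfUnity n (AlgebraicClosure F)) :
    (AlgebraicClosure F)ˣ)

/-- `muFieldVal` is injective. [folklore] -/
theorem muFieldVal_injective {n : ℕ} : Function.Injective (muFieldVal (F := F) (n := n)) :=
  fun _ _ h ↦ muCarrier_eq_iff.mpr h

/-- `muFieldVal (x + y) = muFieldVal x * muFieldVal y`. [folklore] -/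
theorem muFieldVal_add {n : ℕ} (x y : MuCarrier F n) : muFieldVal (x + y) = muFieldVal x * muFieldVal y := rfl

/-- `muFieldVal 0 = 1`. [folklore] -/
theorem muFieldVal_zero {n : ℕ} : muFieldVal (0 : MuCarrier F n) = 1 := rfl

/-- `muFieldVal (-x) = (muFieldVal x)⁻¹`. [folklore] -/
theorem muFieldVal_neg {n : ℕ} (x : MuCarrier F n) : muFieldVal (-x) = (muFieldVal x)⁻¹ := by
  have h : muFieldVal (-x) * muFieldVal x = 1 := by rw [← muFieldVal_add, neg_add_cancel, muFieldVal_zero]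
  have hx : muFieldVal x ≠ 0 := fun h0 ↦ by rw [h0, mul_zero] at h; exact zero_ne_one h
  exact (eq_inv_of_mul_eq_one_left h)

/-- `muFieldVal (x - y) = muFieldVal x / muFieldVal y`. [folklore] -/
theorem muFieldVal_sub {n : ℕ} (x y : MuCarrier F n) : muFieldVal (x - y) = muFieldVal x / muFieldVal y := by
  rw [sub_eq_add_neg, muFieldVal_add, muFieldVal_neg, div_eq_mul_inv]

/-- `muFieldVal (σ ζ) = σ • muFieldVal ζ` for the Galois action of `μₙ`. [folklore] -/
theorem muFieldVal_mu_apply {n : ℕ} (σ : absoluteGaloisGroup F) (x : MuCarrier F n) :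
    muFieldVal (mu F n σ x) = σ • muFieldVal x := by
  unfold muFieldVal
  rw [DiscreteGaloisModule.mu_apply_apply, toMul_ofMul, absoluteGaloisGroup.coe_smul_rootsOfUnity,
    Units.coe_smul]

/-- An `n`-th root of unity `a ∈ F̄`, as an element of `MuCarrier F n` (junk value `0` if
`aⁿ ≠ 1`). [folklore] -/
def muOfFieldVal (n : ℕ) [NeZero n] (a : AlgebraicClosure F) : MuCarrier F n :=
  if h : a ^ n = 1 then MuCarrier.ofRootsOfUnity (rootsOfUnity.mkOfPowEq a h) else 0

/-- `muFieldVal (muOfFieldVal a) = a` for `aⁿ = 1`. [folklore] -/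
theorem muFieldVal_muOfFieldVal {n : ℕ} [NeZero n] {a : AlgebraicClosure F} (h : a ^ n = 1) :
    muFieldVal (muOfFieldVal n a) = a := by
  rw [muOfFieldVal, dif_pos h]
  rfl

/-- **The Kummer image is isotropic for the Weil-pairing cup product** — discharge of the named
fact `kummerClass_cupProduct_kummerClass_eq_zero` (Poonen–Rains 2012, Prop. 4.8 with Cor. 4.6;
used by Gross 1991, proof of Prop. 8.2, and McCallum 1991): for an elliptic curve `E = W` over a
perfect field `F`, `n ≥ 1` invertible in `F`, every alternating biadditive `Γ_F`-equivariant
`μₙ`-valued pairing `e` on `E[n]` and all `Q₁, Q₂ ∈ E(F̄)` with `nQᵢ ∈ E(F)`,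
`[σ ↦ σQ₁ - Q₁] ∪ₑ [σ ↦ σQ₂ - Q₂] = 0` in `H²(F, μₙ)`.

Proof.  (1) `e = e_n^c` pointwise for the Weil pairing `e_n` of the tree
(`WeierstrassCurve.weilPairingFun`, Silverman's `τ_S^* g_T / g_T`) and some `c`
(`exists_pairing_eq_weilPairingFun_pow`: `E[n] = ⟨P₀, Q₀⟩` with `e_n(P₀, Q₀)` primitive).
(2) Writing `Q₂ = nQ₂'`, the cup-product cocycle is `(σ, τ) ↦ e(σQ₁ - Q₁, σ(τQ₂ - Q₂))`
(`ContPairing.cupCocycle_apply_eq_smul`), and `e_n(σQ₁ - Q₁, σ(τQ₂ - Q₂)) · b(στ) = b(σ) σb(τ)`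
for a locally constant `μₙ`-valued `b` (`exists_mu_coboundary`: the Weil functions
`g_σ = τ_{Q₂'}^*(σ̃Ψ/Ψ)`, `h_σ = τ_{Q₁+Q₂'}^*(σ̃Ψ'/Ψ')` for the same point `σQ₂ - Q₂` are
proportional, `h_σ = u_σ g_σ`, and comparing their exact cocycle identities
`g_{στ} = g_σ · τ^*(σ̃ g_τ)` through `τ_S^* g = e_n(S, ·) g` gives `∂u = e_n(⋯)`; Hilbert 90
normalises `u` into `μₙ`).  (3) Hence the cocycle of `e = e_n^c` is the coboundary of the
continuous cochain `b^c`, and its class vanishes (`twoCocycleClass_eq_zero_iff`).  This is the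
argument of Poonen–Rains, Prop. 4.8 (the Kummer classes lift to the Heisenberg group, so the
quadratic form `q` vanishes on them) and Cor. 4.6 (Zarhin: the bilinear form of `q` is the cup
product), with the theta group replaced by explicit Weil functions.
[cite: PoonenRains2012, Prop. 4.8 and Cor. 4.6] [cite: SilvermanAEC2009, III.§8] -/
theorem kummerClass_cupProduct_kummerClass_eq_zero_holds :
    ∀ (F : Type u) [Field F], kummerClass_cupProduct_kummerClass_eq_zero F := by
  intro F _ _ W _ n _ hnF e hμ hadd₁ hadd₂ halt hgal Q₁ Q₂ hQ₁ hQ₂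
  have hn0 : n ≠ 0 := NeZero.ne n
  have hnZ : (n : ℤ) ≠ 0 := intCast_ne_zero_of_natCast_ne_zero hnF
  -- (1) `e` is a power of the Weil pairing
  obtain ⟨c, hc⟩ := exists_pairing_eq_weilPairingFun_pow hnF e hμ hadd₁ hadd₂ halt
  -- (2) an `n`-th root `Q₂'` of `Q₂` and the `μₙ`-valued cochain `b`
  obtain ⟨Q₂', hQ₂'⟩ := zsmul_geomPoints_surjective_holds W hnZ Q₂
  change (n : ℤ) • Q₂' = Q₂ at hQ₂'
  subst hQ₂'
  obtain ⟨b, hblc, hbn, hbI⟩ := exists_mu_coboundary hnF hQ₁ hQ₂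
  have hb0 : ∀ σ, b σ ≠ 0 := fun σ h0 ↦ by
    have := hbn σ
    rw [h0, zero_pow hn0] at this
    exact zero_ne_one this
  -- the cochain `b^c`, with values in `μₙ`, as a continuous map to the carrier of `μₙ`
  have hbcn : ∀ σ, (b σ ^ c) ^ n = 1 := fun σ ↦ by rw [← pow_mul, mul_comm, pow_mul, hbn, one_pow]
  have hbclc : IsLocallyConstant fun σ ↦ muOfFieldVal n (b σ ^ c) := hblc.comp fun a ↦ muOfFieldVal n (a ^ c)
  let β : C(absoluteGaloisGroup F, MuCarrier F n) := ⟨fun σ ↦ muOfFieldVal n (b σ ^ c), hbclc.continuous⟩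
  have hβ : ∀ σ, muFieldVal (β σ) = b σ ^ c := fun σ ↦ muFieldVal_muOfFieldVal (hbcn σ)
  -- (3) the cup product on cocycles, and the coboundary criterion
  change (weilContPairing W n e hμ hadd₁ hadd₂ hgal).cupProduct
      (oneCocycleClass (W.torsionGaloisModule n).toTopRep (kummerCocycleTorsion W n Q₁ hQ₁))
      (oneCocycleClass (W.torsionGaloisModule n).toTopRep
        (kummerCocycleTorsion W n ((n : ℤ) • Q₂') hQ₂)) = 0
  rw [ContPairing.cupProduct_oneCocycleClass_eq_twoCocycleClass, twoCocycleClass_eq_zero_iff]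
  refine ⟨β, fun σ τ ↦ ?_⟩
  rw [ContPairing.cupCocycle_apply_eq_smul]
  apply muFieldVal_injective
  -- both sides as elements of `F̄`
  have hL : muFieldVal ((weilContPairing W n e hμ hadd₁ hadd₂ hgal).toLin
      ((kummerCocycleTorsion W n Q₁ hQ₁).1 σ)
      ((W.torsionGaloisModule n).toTopRep.ρ σ ((kummerCocycleTorsion W n ((n : ℤ) • Q₂') hQ₂).1 τ))) =
      weilPairingFun hnF (σ • Q₁ - Q₁) (σ • (τ • ((n : ℤ) • Q₂') - (n : ℤ) • Q₂')) ^ c := by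
    rw [weilContPairing_toLin_apply]
    change e _ _ = _
    rw [hc]
    rfl
  have hR : muFieldVal ((mu F n).toTopRep.ρ σ (β τ) - β (σ * τ) + β σ) =
      σ • (b τ ^ c) / b (σ * τ) ^ c * b σ ^ c := by
    rw [muFieldVal_add, muFieldVal_sub, hβ, hβ]
    change muFieldVal (mu F n σ (β τ)) / _ * _ = _
    rw [muFieldVal_mu_apply, hβ]
  rw [hL, hR]
  have hI := congrArg (fun z ↦ z ^ c) (hbI σ τ)
  simp only [mul_pow, ← smul_pow'] at hI
  have hne : b (σ * τ) ^ c ≠ 0 := pow_ne_zero _ (hb0 _)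
  field_simp
  linear_combination hI

end Literature.NumberTheory.EllipticCurves

end
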